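import Summits.QuantumFields.YangMills.Theorems.FluctuationComparisonRegPrIntLS2BetaHFlatOfRelativeLetter
import Summits.QuantumFields.YangMills.Theorems.FluctuationComparisonRegPrIntLS2BetaWhitneyHatLiftRelative
import Summits.QuantumFields.YangMills.Theorems.FluctuationComparisonRegPrIntLS2BetaClosePairOfOneStep
import Summits.QuantumFields.YangMills.Theorems.UnitScaleTiltMinimiserStabilityRegPrAvgActionDefect
import HarnessLib

/-!
# S2β · strata residue of GAP♯∘ — THE REL-TEL DOCK: THE GAUGED DISTANCE LETTER (D♮) OF ✓p821904 ⟸ (R1)-chord + ONE DISPLAYED TWO-TOWER ONE-LEVEL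
# LETTER {(L♭) chart, (H♭) relative flap} IN THE REGISTERED CHORD CURRENCY — two stage towers, an EXACT split, the variable-ratio recursion and an
# EXACT relative exit, all by name

Cell `ym3-torus` (YM ladder rung R3 = continuum `SU(2)` Yang–Mills on the three-torus — a RUNG: NOT d = 4, NOT infinite volume, NOT a mass gap,
NOT Clay).  Width seat «width 12» `ym3-torus-px12` (gen 24), FREE px helper on crux `stmt-QuantumFields-20520`
(`Theses.UnitScaleTilt.FluctuationComparisonRegPrIntL`); `--kind proof --supports stmt-QuantumFields-20520 --as helper`, count-neutral, DEFINITION-FREE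
(0 `def`, 0 `instance`, 0 `notation`, 0 `sorry`, default heartbeats).  Lane: ★★OWNER RULING №88 (2) «(D♮) = the REL-TEL road's OUTPUT SHAPE; px12
successor lane»; UV3-NODE §71.3 + addendum + erratum (px12 g23), §75.3 (px16 g20), §75.8 (2) (px16 g21).

WHAT.  The TWO-TOWER twin of px17 g19's ✓`…S2BetaHFlatOfRelativeLetter.dockB_inner` ∕ `hFlat_of_letter` (the ONE-tower `hFlat` dock over the flat datum),
run in the REGISTERED chord currency `dist1(a·b⁻¹) = ‖su2Quat a − su2Quat b‖_ℍ` (✓`UnitScaleTiltSU2NearCommuting.dist1_mul_inv_eq_norm_sub`).  For a pair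
`U, U₀` of one fibre (`M^{K−J}U = M^{K−J}U₀`, ✓`iter_eq_of_mem_fibre`) and ANY family of lift maps with px12 g23's (R1) in its CHORD READING
`Σ_b dist1((lift X)b·((lift X̃)b)⁻¹)² ≤ L·Σ_e ‖log X e − log X̃ e‖²` (✓`…WhitneyHatLiftRelative.sum_dist1_sq_lift_mul_inv_le` at `d = 3`: OPERATOR fact, NO guard):
* run ✓`exists_stageGaugeTower` TWICE — `g` on `U`, `g₀` on `U₀` (`U′_j := g_j • M^jU`, `U′₀_j := g₀_j • M^jU₀`, `V_j := lift_j U′_{j+1}`, `V₀_j := lift_j U′₀_{j+1}`,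
  flaps `P_j := U′_j·V_j⁻¹`, `P₀_j := U′₀_j·V₀_j⁻¹` bondwise);
* LEVEL ENERGY `B_j := ‖dist1(U′_j·U′₀_j⁻¹)‖_{ℓ²}`; `B_{K−J} = 0` (common top, (T1) twice); the SPLIT IS EXACT GROUP ALGEBRA (§1 `dist1_mul_mul_inv_mul_le`:
  `U′·U′₀⁻¹ = (P·P₀⁻¹)·(P₀·(V·V₀⁻¹)·P₀⁻¹)` ⟹ `dist1(U′·U′₀⁻¹) ≤ dist1(P·P₀⁻¹) + dist1(V·V₀⁻¹)`, any `GaugeGroup` — NO BCH∕commutator junk, no `π∕2`);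
* DISPLAYED HYPOTHESIS «TWO-TOWER ONE-LEVEL LETTER» with TWO profiles `r, e ≥ 0`, `Σ_{j<K−J} (r_j + e_j) ≤ E`, for every pair of gauge families `(g, g₀)`
  with the tower facts (T0)–(T5) for `(g, U)` AND for `(g₀, U₀)`:
      (L♭) CHART    `‖log U′_{j+1} − log U′₀_{j+1}‖_{ℓ²} ≤ (1 + r_j)·B_{j+1}`                       (log vs chord on SMALL fields: `r_j = O(s_{j+1}²)`, the sup budget),
      (H♭) REL-FLAP `‖dist1(P_j·P₀_j⁻¹)‖_{ℓ²} ≤ √L·e_j·B_{j+1} + C·(√L)^j·S`                         (j < K − J),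
  SOURCE `S := ‖dist1((U′₀_0 ∂·)⁻¹·(U′_0 ∂·))‖_{ℓ²}` = the relative plaquette field of the pair read in the two BOTTOM stage gauges;
* hence `B_j ≤ √L(1 + r_j + e_j)B_{j+1} + C(√L)^j·S`, px16 g20's ✓`recursion_varRatio_sqrtL_le` + ✓`hFlat_currency_of_recursion'` VERBATIM ⟹
  `((L−1)∕(exp E·C))²·L^{−2(K−J)}·B_0² ≤ S²`;
* RELATIVE EXIT (§1), EXACT: `w := g_0⁻¹·g₀_0` is RESIDUAL (the residual set is a group, ✓`residual_of_iter_eq`); `dist1(U ℓ·((w•U₀) ℓ)⁻¹) = dist1(U′_0 ℓ·(U′₀_0 ℓ)⁻¹)`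
  (conjugation), so `d²(U, w•U₀) = B_0²`; and `S² = Σ_p dist1((plaqHol (w•U₀) p)⁻¹·plaqHol U p)² = 2·Σ_p (1 − reTr(…))` (conjugation by `g_0(x)` +
  ✓`one_sub_reTr_eq_half_dist1_sq_su2`);
so §2 ★★★`dockRel_inner` concludes THE (D♮) BODY of ✓p821904 `gapStratum_of_gaugedLetters`'s hypothesis `hD` at the pair: `∃ w residual ∧
N⁻²·Σ_ℓ dist1(U ℓ·((w•U₀)ℓ)⁻¹)² ≤ C_D·Σ_p (1 − reTr((plaqHol (w•U₀) p)⁻¹·plaqHol U p))`, `C_D := 2·(exp E·C∕(L−1))²` — DEPTH-FREE; and §3 ★★★`relGauge_of_letter`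
threads the letter, stated in `hD`'s own prefix (guard `G` arbitrary; `∃ γ₁ ∃ E ∃ C` where `hD` has `∃ γ₁ ∃ C_D`), into `hD` VERBATIM — so
`gapStratum_of_gaugedLetters G (relGauge_of_letter G lift hR1 HL) hF` types (dock certificate rc 0 in the seat's HOME slot).

WHY CHORD CURRENCY (finding, bus 11:53:54Z).  In log-chart currency the flap `(log U′ − log V) − (log U′₀ − log V₀)` is not a function of `P, P₀` alone
(`log(P·V) − log V = log P + O(|log P|·|log V|)`, BCH) and would owe a new joint-Lipschitz chart letter; in chord currency the split is exact and the flap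
side IS the `δ`-currency of px10 g23's ✓p822074 `…RelativeStokes` (`dist1(X₀⁻¹X) = dist1(X·X₀⁻¹)`) and of px13 g22's F2 `sq_sum_le_plaq`; the only price is
(L♭), a scalar small-field chart fact (own lineage §71 addendum: `(s∕sin s)`, depth-free by the erratum since `s_{j+1}` is geometric in stage gauges).
WHERE THE BRICKS DOCK (read off the letter; none of it is proved here).  (H♭) ⟸ relative field letter in `δ`-currency (px13's F2 shape made two-tower:
products along the SAME combs by (T4) twice) + px10 g23's RELATIVE KEY LEMMA (BRICK 1∕2∕3 → (Σ3)) `‖δ(M^jU, M^jU₀)‖₂ ≤ e(√L)^j·‖δ(U, U₀)‖₂ + Σ SIZE × ARC`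
read in the bottom gauges by conjugation (§1 `dist1_rel_plaqHol_gaugeAct_pair`: `δ_p` of the gauged pair IS `δ_p(U, w•U₀)` — §75.8 (2) «work in the relative
axial gauge and never see an infimum», by kernel) + (F3)-rel ✓p821688 + corr-rel; (L♭) ⟸ sup budget (px16 g20 ✓`…ContractingSupRecursion` ∕ px17
✓`…RelativeTowerSupProfile`) + one chart inequality.  BKG ∕ CRIT-m♮ ∕ MULT♮ ∕ AVG₂♮ (the (F♮) side) do not enter.

HONEST SCOPE.  Quantifier ∕ `ℓ²` plumbing over landed theorems, by name; (L♭) ∧ (H♭) is an undischarged HYPOTHESIS carrying ALL of (D♮)'s analytic content;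
nothing of Bałaban's analysis is asserted or proved ([Balaban1985RegularSpaces] (1.29) p.81 geodesic interpolation in local axial gauges; [Balaban1985Variational]
(4) p.278 the residual group, Thm 1 (8)–(10) p.279 the regular minimiser; [Balaban1984PropagatorsI] Prop. 1.1 (1.89)–(1.90) p.33 the quadratic floor's printed
locus, RULING №75); (D♮), (F♮), `hIrr`, `hA`, TUBE-REG∘, GAP♯∘ (`stub_uniformFibreGapOrbit`), EXW∘, DET-REP-B, S2β, crux 20520, 19936, 19200 and `YM3TorusSU2`
are NOT proved; no registered stub is closed (registry `Lines/semiclassical_s2beta.lean` 3732b7df untouched); rung R3 = SU(2) YM₃ on T³ at fixed lattice data —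
NOT d = 4, NOT infinite volume, NOT a mass gap, NOT Clay; the Yang–Mills mass gap is NOT proved.
References: T. Bałaban, CMP **95** (1984) 17–40 [Balaban1984PropagatorsI]; CMP **98** (1985) 17–51 [Balaban1985Averaging] ((8)–(9) p.19); CMP **99** (1985)
75–102 [Balaban1985RegularSpaces]; CMP **102** (1985) 277–309 [Balaban1985Variational]; CMP **109** (1987) 249–301 [Balaban1987RG1] ((0.11) p.253, p.256).
-/

set_option autoImplicit false

noncomputable section

namespace Summit.QuantumFields.YangMills.Theorems.FluctuationComparisonRegPrIntLS2BetaRelGaugeOfRelativeLetter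

open Finset
open scoped Real
open Literature.MathematicalPhysics.QuantumLattice (su2Quat)
open Literature.MathematicalPhysics.QuantumFieldTheory.Balaban1983to89
open T4Continuum T3ContinuumYM3Torus T3UnitScaleTilt T3TiltDescent T3LevelShift BlockAveraging
open T4CubeChartGnomonic (SU2)
open T4ExpWindowSmallField (logVec expPoint_logVec)
open T3UnitLawDensityEML (ℰp)
open T3ConstrainedMinimiser (fibre)
open T3PrintedRegularMinimiser (minActionRegPr)
open B10Eq27TorusAxialLog (axialT)
open Summit.QuantumFields.YangMills.Theorems.FluctuationComparisonRegPrIntLS2BetaStageGaugeTower (exists_stageGaugeTower)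
open Summit.QuantumFields.YangMills.Theorems.FluctuationComparisonRegPrIntLS2BetaArcBondSplit (sqrt_sum_sq_le_of_le_add)
open Summit.QuantumFields.YangMills.Theorems.FluctuationComparisonRegPrIntLS2BetaSqrtLRecursion (recursion_varRatio_sqrtL_le hFlat_currency_of_recursion')
open Summit.QuantumFields.YangMills.Theorems.FluctuationComparisonRegPrIntLS2BetaWhitneyHatLiftRelative (dist1_expPoint_mul_inv_expPoint_le)
open Summit.QuantumFields.YangMills.Theorems.FluctuationComparisonRegPrIntLS2BetaHFlatOfRelativeLetter (residual_of_iter_eq)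
open Summit.QuantumFields.YangMills.Theorems.FluctuationComparisonRegPrIntLS2BetaResidualGauge (gaugeAct_mul_eq)
open Summit.QuantumFields.YangMills.Theorems.FluctuationComparisonRegPrIntLS2BetaClosePairOfOneStep (iter_eq_of_mem_fibre)
open Summit.QuantumFields.YangMills.Theorems.AvgActionDefect (one_sub_reTr_eq_half_dist1_sq_su2)

open scoped Matrix.Norms.L2Operator

/-! ## §1 The relative EXIT: two gauges make ONE relative gauge `w := g⁻¹·g₀` -/

section Exit

variable {P : Params} {j : ℕ} {G : Type*} [GaugeGroup G]

/-- **RELATIVE BOND, TWO GAUGES ⟹ ONE**: `dist1 ((g•U) ℓ · ((g₀•U₀) ℓ)⁻¹) = dist1 (U ℓ · ((w•U₀) ℓ)⁻¹)` with `w := g⁻¹·g₀` (conjugation by `g(ℓ₋)`).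
[cite: Balaban1985Averaging, (8) p.19] -/
theorem dist1_gaugeAct_mul_inv_gaugeAct (g g₀ : Site P j → G) (U U₀ : GaugeField P j G) (ℓ : PBond P j) :
    dist1 (GaugeField.gaugeAct g U ℓ * (GaugeField.gaugeAct g₀ U₀ ℓ)⁻¹) =
      dist1 (U ℓ * (GaugeField.gaugeAct (fun x => (g x)⁻¹ * g₀ x) U₀ ℓ)⁻¹) := by
  have e : GaugeField.gaugeAct g U ℓ * (GaugeField.gaugeAct g₀ U₀ ℓ)⁻¹ =
      g ℓ.src * (U ℓ * (GaugeField.gaugeAct (fun x => (g x)⁻¹ * g₀ x) U₀ ℓ)⁻¹) * (g ℓ.src)⁻¹ := by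
    show g ℓ.src * U ℓ * (g ℓ.tgt)⁻¹ * (g₀ ℓ.src * U₀ ℓ * (g₀ ℓ.tgt)⁻¹)⁻¹ =
      g ℓ.src * (U ℓ * ((g ℓ.src)⁻¹ * g₀ ℓ.src * U₀ ℓ * ((g ℓ.tgt)⁻¹ * g₀ ℓ.tgt)⁻¹)⁻¹) * (g ℓ.src)⁻¹
    group
  rw [e, GaugeGroup.dist1_conj]

/-- **RELATIVE PLAQUETTE, TWO GAUGES ⟹ ONE** (group identity): `(plaqHol (g₀•U₀) p)⁻¹ · plaqHol (g•U) p` is the conjugate by `g(p₋)` of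
`(plaqHol (w•U₀) p)⁻¹ · plaqHol U p`, `w := g⁻¹·g₀` (✓`plaqHol_gaugeAct`). [cite: Balaban1985Averaging, (8)-(9) p.19] -/
theorem rel_plaqHol_gaugeAct_pair_eq_conj (g g₀ : Site P j → G) (U U₀ : GaugeField P j G) (p : Plaq P j) :
    (GaugeField.plaqHol (GaugeField.gaugeAct g₀ U₀) p)⁻¹ * GaugeField.plaqHol (GaugeField.gaugeAct g U) p =
      g p.src * ((GaugeField.plaqHol (GaugeField.gaugeAct (fun x => (g x)⁻¹ * g₀ x) U₀) p)⁻¹ * GaugeField.plaqHol U p) * (g p.src)⁻¹ := by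
  rw [T4WilsonGaugeFlatDirection.plaqHol_gaugeAct, T4WilsonGaugeFlatDirection.plaqHol_gaugeAct,
    T4WilsonGaugeFlatDirection.plaqHol_gaugeAct]
  group

/-- `dist1` reading: `dist1 ((plaqHol (g₀•U₀) p)⁻¹ · plaqHol (g•U) p) = dist1 ((plaqHol (w•U₀) p)⁻¹ · plaqHol U p)`, `w := g⁻¹·g₀` — the source `δ_p` of the
gauged pair IS the gauge-free relative plaquette of `(U, w•U₀)`. [cite: Balaban1985Averaging, (8)-(9) p.19] -/
theorem dist1_rel_plaqHol_gaugeAct_pair (g g₀ : Site P j → G) (U U₀ : GaugeField P j G) (p : Plaq P j) :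
    dist1 ((GaugeField.plaqHol (GaugeField.gaugeAct g₀ U₀) p)⁻¹ * GaugeField.plaqHol (GaugeField.gaugeAct g U) p) =
      dist1 ((GaugeField.plaqHol (GaugeField.gaugeAct (fun x => (g x)⁻¹ * g₀ x) U₀) p)⁻¹ * GaugeField.plaqHol U p) := by
  rw [rel_plaqHol_gaugeAct_pair_eq_conj, GaugeGroup.dist1_conj]

end Exit

/-- **THE TWO-TOWER SPLIT IS EXACT GROUP ALGEBRA** (any `GaugeGroup`): `dist1 ((P·V)·(P₀·V₀)⁻¹) ≤ dist1 (P·P₀⁻¹) + dist1 (V·V₀⁻¹)`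
(`(P·V)·(P₀·V₀)⁻¹ = (P·P₀⁻¹)·(P₀·(V·V₀⁻¹)·P₀⁻¹)`, `dist1_mul_le`, `dist1_conj`; px10 g23's ✓`…RelativeStokes.dist1_rel_mul_le` is the left-relative
orientation). [cite: Balaban1985Averaging, (8) p.19] -/
theorem dist1_mul_mul_inv_mul_le {G : Type*} [GaugeGroup G] (P V P₀ V₀ : G) :
    dist1 (P * V * (P₀ * V₀)⁻¹) ≤ dist1 (P * P₀⁻¹) + dist1 (V * V₀⁻¹) := by
  have e : P * V * (P₀ * V₀)⁻¹ = P * P₀⁻¹ * (P₀ * (V * V₀⁻¹) * P₀⁻¹) := by group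
  rw [e]
  exact (GaugeGroup.dist1_mul_le _ _).trans (by rw [GaugeGroup.dist1_conj])

/-- The split read on a bond of the two towers: `dist1 (U′·U′₀⁻¹) ≤ dist1 ((U′·V⁻¹)·(U′₀·V₀⁻¹)⁻¹) + dist1 (V·V₀⁻¹)` (the flap pair, then the lift pair).
[cite: Balaban1985Averaging, (8) p.19] -/
theorem dist1_mul_inv_le_flap_add_lift {G : Type*} [GaugeGroup G] (U' V U'₀ V₀ : G) :
    dist1 (U' * U'₀⁻¹) ≤ dist1 (U' * V⁻¹ * (U'₀ * V₀⁻¹)⁻¹) + dist1 (V * V₀⁻¹) := by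
  have h := dist1_mul_mul_inv_mul_le (U' * V⁻¹) V (U'₀ * V₀⁻¹) V₀
  rwa [inv_mul_cancel_right, inv_mul_cancel_right] at h

/-- **SOURCE ↔ RELATIVE ACTION** on `SU(2)`: `Σ_p dist1 (E_p)² = 2·Σ_p (1 − reTr E_p)` (✓`one_sub_reTr_eq_half_dist1_sq_su2` termwise). [folklore] -/
theorem sum_dist1_sq_eq_two_mul_sum_one_sub_reTr {ι : Type*} (s : Finset ι) (E : ι → SU2) :
    ∑ i ∈ s, dist1 (E i) ^ 2 = 2 * ∑ i ∈ s, (1 - reTr (E i)) := by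
  rw [mul_sum]
  exact sum_congr rfl fun i _ => by rw [one_sub_reTr_eq_half_dist1_sq_su2]; ring

variable (F : T3Family) {J K : ℕ}

/-! ## §2 The two-tower recursion end to end, one fibre pair, with the letter (L♭) ∧ (H♭) displayed -/

/-- ★★★ **REL-TEL DOCK, INNER FORM** (one run pair `J ≤ K`, one fibre pair `U, U₀ ∈ fibre(V)`, the (0.4) average, ANY lift with px12 g23's (R1) in its
chord reading).  HYPOTHESIS = «THE TWO-TOWER ONE-LEVEL LETTER»: for EVERY pair of gauge families `g`, `g₀` with the stage tower's (T0) formula, (T1) top,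
(T2) nesting, (T3) covariance, (T4) comb axiality and (T5) one-step consistency — `g` relative to `U`, `g₀` relative to `U₀` — there are profiles `r, e ≥ 0`
with `Σ_{j<K−J} (r_j + e_j) ≤ E` such that at every level (L♭) `‖log U′_{j+1} − log U′₀_{j+1}‖_{ℓ²} ≤ (1 + r_j)·B_{j+1}` and (H♭) the RELATIVE FLAP
`‖dist1(P_j·P₀_j⁻¹)‖_{ℓ²} ≤ √L·e_j·B_{j+1} + C·(√L)^j·‖dist1((U′₀_0 ∂·)⁻¹·U′_0 ∂·)‖_{ℓ²}` (`B_j := ‖dist1(U′_j·U′₀_j⁻¹)‖_{ℓ²}`, `P_j := U′_j·V_j⁻¹`).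
CONCLUSION: the (D♮) body at the pair with the EXPLICIT `C_D = 2·(exp E·C∕(L−1))²` and the relative gauge `w := g_0⁻¹·g₀_0` of the two towers.
[cite: Balaban1985RegularSpaces, (1.29) p.81; Balaban1985Variational, (4) p.278; Balaban1984PropagatorsI, Prop. 1.1 (1.89)-(1.90) p.33] -/
theorem dockRel_inner (hJK : J ≤ K) (hL : 1 < (F.L : ℝ)) {V : GaugeField (F.P J) 0 SU2}
    (U U₀ : GaugeField (F.P K) 0 SU2) (hU : U ∈ fibre F ℰp J K hJK V) (hU₀ : U₀ ∈ fibre F ℰp J K hJK V)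
    (lift : (j : ℕ) → GaugeField (F.P K) (j + 1) SU2 → GaugeField (F.P K) j SU2)
    (hR1 : ∀ j, j < K - J → ∀ X X' : GaugeField (F.P K) (j + 1) SU2,
      ∑ b, dist1 (lift j X b * (lift j X' b)⁻¹) ^ 2 ≤ (F.L : ℝ) * ∑ e, ‖logVec (su2Quat (X e)) - logVec (su2Quat (X' e))‖ ^ 2)
    (C E : ℝ) (hC : 0 < C)
    (H : ∀ g g₀ : (j : ℕ) → Site (F.P K) j → SU2,
      (∀ j, j < K - J → ∀ x, g j x =
        (axialT (lift j (GaugeField.gaugeAct (g (j + 1)) (Averaging.iter (fun k => blockAvg (P := F.P K) (j := k) ℰp) (j + 1) U)))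
            (emb (blockOf x)) x)⁻¹ *
          g (j + 1) (blockOf x) * axialT (Averaging.iter (fun k => blockAvg (P := F.P K) (j := k) ℰp) j U) (emb (blockOf x)) x) →
      (∀ j, K - J ≤ j → ∀ y, g j y = 1) →
      (∀ j, j < K - J → ∀ y : Site (F.P K) (j + 1), g j (emb y) = g (j + 1) y) →
      (∀ X : GaugeField (F.P K) 0 SU2, ∀ j, j ≤ K - J →
        Averaging.iter (fun k => blockAvg (P := F.P K) (j := k) ℰp) j (GaugeField.gaugeAct (g 0) X) =
          GaugeField.gaugeAct (g j) (Averaging.iter (fun k => blockAvg (P := F.P K) (j := k) ℰp) j X)) →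
      (∀ j, j < K - J → ∀ x,
        axialT (GaugeField.gaugeAct (g j) (Averaging.iter (fun k => blockAvg (P := F.P K) (j := k) ℰp) j U)) (emb (blockOf x)) x =
          axialT (lift j (GaugeField.gaugeAct (g (j + 1)) (Averaging.iter (fun k => blockAvg (P := F.P K) (j := k) ℰp) (j + 1) U)))
            (emb (blockOf x)) x) →
      (∀ j, j < K - J →
        (blockAvg (P := F.P K) (j := j) ℰp).avg (GaugeField.gaugeAct (g j) (Averaging.iter (fun k => blockAvg (P := F.P K) (j := k) ℰp) j U)) =
          GaugeField.gaugeAct (g (j + 1)) (Averaging.iter (fun k => blockAvg (P := F.P K) (j := k) ℰp) (j + 1) U)) →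
      (∀ j, j < K - J → ∀ x, g₀ j x =
        (axialT (lift j (GaugeField.gaugeAct (g₀ (j + 1)) (Averaging.iter (fun k => blockAvg (P := F.P K) (j := k) ℰp) (j + 1) U₀)))
            (emb (blockOf x)) x)⁻¹ *
          g₀ (j + 1) (blockOf x) * axialT (Averaging.iter (fun k => blockAvg (P := F.P K) (j := k) ℰp) j U₀) (emb (blockOf x)) x) →
      (∀ j, K - J ≤ j → ∀ y, g₀ j y = 1) →
      (∀ j, j < K - J → ∀ y : Site (F.P K) (j + 1), g₀ j (emb y) = g₀ (j + 1) y) →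
      (∀ X : GaugeField (F.P K) 0 SU2, ∀ j, j ≤ K - J →
        Averaging.iter (fun k => blockAvg (P := F.P K) (j := k) ℰp) j (GaugeField.gaugeAct (g₀ 0) X) =
          GaugeField.gaugeAct (g₀ j) (Averaging.iter (fun k => blockAvg (P := F.P K) (j := k) ℰp) j X)) →
      (∀ j, j < K - J → ∀ x,
        axialT (GaugeField.gaugeAct (g₀ j) (Averaging.iter (fun k => blockAvg (P := F.P K) (j := k) ℰp) j U₀)) (emb (blockOf x)) x =
          axialT (lift j (GaugeField.gaugeAct (g₀ (j + 1)) (Averaging.iter (fun k => blockAvg (P := F.P K) (j := k) ℰp) (j + 1) U₀)))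
            (emb (blockOf x)) x) →
      (∀ j, j < K - J →
        (blockAvg (P := F.P K) (j := j) ℰp).avg (GaugeField.gaugeAct (g₀ j) (Averaging.iter (fun k => blockAvg (P := F.P K) (j := k) ℰp) j U₀)) =
          GaugeField.gaugeAct (g₀ (j + 1)) (Averaging.iter (fun k => blockAvg (P := F.P K) (j := k) ℰp) (j + 1) U₀)) →
      ∃ r e : ℕ → ℝ, (∀ j, 0 ≤ r j) ∧ (∀ j, 0 ≤ e j) ∧ ∑ j ∈ range (K - J), (r j + e j) ≤ E ∧
        ∀ j, j < K - J →
          √(∑ b, ‖logVec (su2Quat (GaugeField.gaugeAct (g (j + 1)) (Averaging.iter (fun k => blockAvg (P := F.P K) (j := k) ℰp) (j + 1) U) b)) -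
                logVec (su2Quat (GaugeField.gaugeAct (g₀ (j + 1)) (Averaging.iter (fun k => blockAvg (P := F.P K) (j := k) ℰp) (j + 1) U₀) b))‖ ^ 2) ≤
            (1 + r j) * √(∑ b, dist1 (GaugeField.gaugeAct (g (j + 1)) (Averaging.iter (fun k => blockAvg (P := F.P K) (j := k) ℰp) (j + 1) U) b *
              (GaugeField.gaugeAct (g₀ (j + 1)) (Averaging.iter (fun k => blockAvg (P := F.P K) (j := k) ℰp) (j + 1) U₀) b)⁻¹) ^ 2) ∧
          √(∑ b, dist1 (GaugeField.gaugeAct (g j) (Averaging.iter (fun k => blockAvg (P := F.P K) (j := k) ℰp) j U) b *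
                (lift j (GaugeField.gaugeAct (g (j + 1)) (Averaging.iter (fun k => blockAvg (P := F.P K) (j := k) ℰp) (j + 1) U)) b)⁻¹ *
              (GaugeField.gaugeAct (g₀ j) (Averaging.iter (fun k => blockAvg (P := F.P K) (j := k) ℰp) j U₀) b *
                (lift j (GaugeField.gaugeAct (g₀ (j + 1)) (Averaging.iter (fun k => blockAvg (P := F.P K) (j := k) ℰp) (j + 1) U₀)) b)⁻¹)⁻¹) ^ 2) ≤
            Real.sqrt (F.L : ℝ) * e j * √(∑ b, dist1 (GaugeField.gaugeAct (g (j + 1)) (Averaging.iter (fun k => blockAvg (P := F.P K) (j := k) ℰp) (j + 1) U) b *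
              (GaugeField.gaugeAct (g₀ (j + 1)) (Averaging.iter (fun k => blockAvg (P := F.P K) (j := k) ℰp) (j + 1) U₀) b)⁻¹) ^ 2) +
              C * Real.sqrt (F.L : ℝ) ^ j *
                √(∑ p, dist1 ((GaugeField.plaqHol (GaugeField.gaugeAct (g₀ 0) U₀) p)⁻¹ * GaugeField.plaqHol (GaugeField.gaugeAct (g 0) U) p) ^ 2)) :
    ∃ w : GaugeTransf (F.P K) 0 SU2,
      (∀ U' : GaugeField (F.P K) 0 SU2, descendTo F ℰp J K hJK (GaugeField.gaugeAct w U') = descendTo F ℰp J K hJK U') ∧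
      ((F.L : ℝ)⁻¹) ^ (2 * (K - J)) * ∑ ℓ : PBond (F.P K) 0, dist1 (U ℓ * ((GaugeField.gaugeAct w U₀) ℓ)⁻¹) ^ 2
        ≤ 2 * (Real.exp E * C / (F.L - 1)) ^ 2 *
          ∑ p : Plaq (F.P K) 0, (1 - reTr ((GaugeField.plaqHol (GaugeField.gaugeAct w U₀) p)⁻¹ * GaugeField.plaqHol U p)) := by
  have hm : K - J ≤ (F.P K).m + (F.P K).K := by show K - J ≤ F.m + K; omega
  set av : ∀ i, Averaging (F.P K) i SU2 := fun k => blockAvg (P := F.P K) (j := k) ℰp with hav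
  obtain ⟨g, hT0, hT1, hT2, hT3, hres, hT6, hT4, hT5⟩ := exists_stageGaugeTower av hm lift U
  obtain ⟨g₀, hT0', hT1', hT2', hT3', hres', hT6', hT4', hT5'⟩ := exists_stageGaugeTower av hm lift U₀
  obtain ⟨r, e, hr0, he0, hE, hH⟩ := H g g₀ hT0 hT1 hT2 hT3 hT4 hT5 hT0' hT1' hT2' hT3' hT4' hT5'
  set B : ℕ → ℝ := fun j => √(∑ b, dist1 (GaugeField.gaugeAct (g j) (Averaging.iter av j U) b *
      (GaugeField.gaugeAct (g₀ j) (Averaging.iter av j U₀) b)⁻¹) ^ 2) with hB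
  set S : ℝ := √(∑ p, dist1 ((GaugeField.plaqHol (GaugeField.gaugeAct (g₀ 0) U₀) p)⁻¹ *
      GaugeField.plaqHol (GaugeField.gaugeAct (g 0) U) p) ^ 2) with hS
  have hB0 : ∀ j, 0 ≤ B j := fun j => Real.sqrt_nonneg _
  -- top: the two towers have the same top field and trivial top gauges
  have htop : B (K - J) = 0 := by
    have h1 : Averaging.iter av (K - J) U = Averaging.iter av (K - J) U₀ := iter_eq_of_mem_fibre F hJK hU hU₀
    have hg : g (K - J) = fun _ => 1 := funext (hT1 (K - J) le_rfl)
    have hg' : g₀ (K - J) = fun _ => 1 := funext (hT1' (K - J) le_rfl)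
    simp only [hB, h1, hg, hg', mul_inv_cancel, GaugeGroup.dist1_one, ne_eq, OfNat.ofNat_ne_zero, not_false_eq_true, zero_pow,
      sum_const_zero, Real.sqrt_zero]
  -- the one-level recursion: EXACT split + (R1)-chord + (L♭) + (H♭)
  have hrec : ∀ j, j < K - J → B j ≤ Real.sqrt (F.L : ℝ) * (1 + (r j + e j)) * B (j + 1) + C * Real.sqrt (F.L : ℝ) ^ j * S := by
    intro j hj
    obtain ⟨hLj, hHj⟩ := hH j hj
    have hsplit := sqrt_sum_sq_le_of_le_add (univ : Finset (PBond (F.P K) j)) (fun b _ => GaugeGroup.dist1_nonneg _)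
      (fun b _ => dist1_mul_inv_le_flap_add_lift
        (GaugeField.gaugeAct (g j) (Averaging.iter av j U) b)
        (lift j (GaugeField.gaugeAct (g (j + 1)) (Averaging.iter av (j + 1) U)) b)
        (GaugeField.gaugeAct (g₀ j) (Averaging.iter av j U₀) b)
        (lift j (GaugeField.gaugeAct (g₀ (j + 1)) (Averaging.iter av (j + 1) U₀)) b))
    have hlift : √(∑ b, dist1 (lift j (GaugeField.gaugeAct (g (j + 1)) (Averaging.iter av (j + 1) U)) b *
        (lift j (GaugeField.gaugeAct (g₀ (j + 1)) (Averaging.iter av (j + 1) U₀)) b)⁻¹) ^ 2) ≤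
        Real.sqrt (F.L : ℝ) * ((1 + r j) * B (j + 1)) := by
      refine (Real.sqrt_le_sqrt (hR1 j hj _ _)).trans ?_
      rw [Real.sqrt_mul (Nat.cast_nonneg _)]
      exact mul_le_mul_of_nonneg_left hLj (Real.sqrt_nonneg _)
    calc B j ≤ _ := hsplit
      _ ≤ (Real.sqrt (F.L : ℝ) * e j * B (j + 1) + C * Real.sqrt (F.L : ℝ) ^ j * S) + Real.sqrt (F.L : ℝ) * ((1 + r j) * B (j + 1)) :=
          add_le_add hHj hlift
      _ = Real.sqrt (F.L : ℝ) * (1 + (r j + e j)) * B (j + 1) + C * Real.sqrt (F.L : ℝ) ^ j * S := by ring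
  have hsol := recursion_varRatio_sqrtL_le (F.L : ℝ) hL B (fun j => C * Real.sqrt (F.L : ℝ) ^ j * S) (fun j => r j + e j) (K - J) htop
    (fun j => add_nonneg (hr0 j) (he0 j)) E hE hrec C S hC.le (Real.sqrt_nonneg _) (fun t _ => le_rfl)
  have hC' : 0 < Real.exp E * C := mul_pos (Real.exp_pos E) hC
  have hL1 : 0 < (F.L : ℝ) - 1 := by linarith
  have hsol' : B 0 ≤ Real.exp E * C * S * ((F.L : ℝ) ^ (K - J) / ((F.L : ℝ) - 1)) := by
    refine hsol.trans (mul_le_mul_of_nonneg_left (div_le_div_of_nonneg_right (by linarith) hL1.le) ?_)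
    exact mul_nonneg hC'.le (Real.sqrt_nonneg _)
  have hcur := hFlat_currency_of_recursion' (F.L : ℝ) (Real.exp E * C) S (B 0) (K - J) hL hC' (hB0 0) hsol'
  -- RELATIVE EXIT: `w := g_0⁻¹·g₀_0`
  refine ⟨fun x => (g 0 x)⁻¹ * g₀ 0 x, ?_, ?_⟩
  · -- residual: `M^{K−J}(w•X) = M^{K−J}(g_0⁻¹•(g₀_0•X)) = M^{K−J}(g₀_0•X) = M^{K−J}X`
    refine residual_of_iter_eq F hJK _ fun X => ?_
    have e1 : GaugeField.gaugeAct (fun x => (g 0 x)⁻¹ * g₀ 0 x) X =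
        GaugeField.gaugeAct (fun x => (g 0 x)⁻¹) (GaugeField.gaugeAct (g₀ 0) X) := by
      rw [← gaugeAct_mul_eq]; rfl
    rw [e1, hT6, hres']
  · -- the bond side is EXACT: `d²(U, w•U₀) = B_0²` (conjugation)
    have hd : ∑ ℓ : PBond (F.P K) 0, dist1 (U ℓ * ((GaugeField.gaugeAct (fun x => (g 0 x)⁻¹ * g₀ 0 x) U₀) ℓ)⁻¹) ^ 2 = B 0 ^ 2 := by
      rw [hB, Real.sq_sqrt (sum_nonneg fun _ _ => sq_nonneg _)]
      exact sum_congr rfl fun ℓ _ => by rw [← dist1_gaugeAct_mul_inv_gaugeAct]; rfl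
    have hSq : S ^ 2 = 2 * ∑ p : Plaq (F.P K) 0,
        (1 - reTr ((GaugeField.plaqHol (GaugeField.gaugeAct (fun x => (g 0 x)⁻¹ * g₀ 0 x) U₀) p)⁻¹ * GaugeField.plaqHol U p)) := by
      rw [hS, Real.sq_sqrt (sum_nonneg fun _ _ => sq_nonneg _), ← sum_dist1_sq_eq_two_mul_sum_one_sub_reTr]
      exact sum_congr rfl fun p _ => by rw [dist1_rel_plaqHol_gaugeAct_pair]
    have hk : 0 < ((F.L : ℝ) - 1) / (Real.exp E * C) := div_pos hL1 hC'
    have h1 : ((F.L : ℝ)⁻¹) ^ (2 * (K - J)) * B 0 ^ 2 ≤ S ^ 2 / (((F.L : ℝ) - 1) / (Real.exp E * C)) ^ 2 := by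
      rw [le_div_iff₀ (pow_pos hk 2)]
      calc ((F.L : ℝ)⁻¹) ^ (2 * (K - J)) * B 0 ^ 2 * (((F.L : ℝ) - 1) / (Real.exp E * C)) ^ 2
          = (((F.L : ℝ) - 1) / (Real.exp E * C)) ^ 2 * ((F.L : ℝ)⁻¹) ^ (2 * (K - J)) * B 0 ^ 2 := by ring
        _ ≤ S ^ 2 := hcur
    have h2 : S ^ 2 / (((F.L : ℝ) - 1) / (Real.exp E * C)) ^ 2 = (Real.exp E * C / ((F.L : ℝ) - 1)) ^ 2 * S ^ 2 := by
      rw [div_pow, div_pow, div_div_eq_mul_div]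
      field_simp
    rw [hd]
    calc ((F.L : ℝ)⁻¹) ^ (2 * (K - J)) * B 0 ^ 2
        ≤ (Real.exp E * C / ((F.L : ℝ) - 1)) ^ 2 * S ^ 2 := h1.trans_eq h2
      _ = 2 * (Real.exp E * C / (F.L - 1)) ^ 2 * ∑ p : Plaq (F.P K) 0,
            (1 - reTr ((GaugeField.plaqHol (GaugeField.gaugeAct (fun x => (g 0 x)⁻¹ * g₀ 0 x) U₀) p)⁻¹ * GaugeField.plaqHol U p)) := by
          rw [hSq]; ring

/-! ## §3 The outer wrapper: the letter in `hD`'s own quantifier prefix gives (D♮) VERBATIM (✓p821904 `gapStratum_of_gaugedLetters`'s `hD`) -/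

/-- ★★★ **REL-TEL DOCK, OUTER FORM — (D♮) VERBATIM FROM THE LETTER.**  If a lift family satisfies (R1) in its chord reading at every `(F, K, J, j)`
(✓`sum_dist1_sq_lift_mul_inv_le` for the geodesic hat lift at `d = 3`), and the two-tower one-level letter (L♭) ∧ (H♭) holds in the prefix of (D♮) —
guard `G` arbitrary; `∃ γ₁ ∃ E ∃ C` in place of `∃ γ₁ ∃ C_D`; at every argmin background `U₀` and every good history `U` of the fibre, for every pair of
stage towers — then the hypothesis `hD` of ✓`…S2BetaStrataOfGaugedLetters.gapStratum_of_gaugedLetters G` holds VERBATIM, with `C_D = 2·(exp E·C∕(L−1))²`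
(`dockRel_inner`; block sizes `L ≤ 1` carry no `T3Family`).
[cite: Balaban1985Variational, (4) p.278, Thm 1 (8)-(10) p.279; Balaban1985RegularSpaces, (1.29) p.81; Balaban1984PropagatorsI, Prop. 1.1 (1.89)-(1.90) p.33] -/
theorem relGauge_of_letter
    (G : (F : T3Family) → (J : ℕ) → GaugeField (F.P J) 0 (Matrix.specialUnitaryGroup (Fin 2) ℂ) → Prop)
    (lift : (F : T3Family) → (K j : ℕ) → GaugeField (F.P K) (j + 1) SU2 → GaugeField (F.P K) j SU2)
    (hR1 : ∀ (F : T3Family) (K J j : ℕ), j < K - J → ∀ X X' : GaugeField (F.P K) (j + 1) SU2,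
      ∑ b, dist1 (lift F K j X b * (lift F K j X' b)⁻¹) ^ 2 ≤ (F.L : ℝ) * ∑ e, ‖logVec (su2Quat (X e)) - logVec (su2Quat (X' e))‖ ^ 2)
    (HL : ∀ (L : ℕ), ∃ c₀ : ℝ, 0 < c₀ ∧ c₀ ≤ 1 ∧ ∀ (cw : ℝ), 0 < cw → cw ≤ c₀ → ∃ pS : ℝ, ∀ (b₀ p₀ : ℝ), 0 < b₀ → pS ≤ p₀ → 0 < p₀ →
      ∃ ε₁ : ℝ, 0 < ε₁ ∧ ∀ (ε₀ : ℝ), 0 < ε₀ → ε₀ ≤ ε₁ →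
      ∃ γ₁ : ℝ, 0 < γ₁ ∧ ∃ E C : ℝ, 0 < C ∧ ∀ (F : T3Family) (γ : ℝ), F.L = L → 0 < γ → γ ≤ γ₁ →
        ∀ (J K : ℕ) (hJK : J ≤ K) (V : GaugeField (F.P J) 0 (Matrix.specialUnitaryGroup (Fin 2) ℂ)), PlaqSmall (θBal F.L γ (cw * b₀) p₀ J) V →
          G F J V →
          ∀ U₀ ∈ {U' : GaugeField (F.P K) 0 (Matrix.specialUnitaryGroup (Fin 2) ℂ) | U' ∈ fibre F ℰp J K hJK V ∧ U' ∈ histGood F ℰp (θBal F.L γ b₀ p₀) K J ∧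
              wilsonAction4 U' = minActionRegPr F J K hJK ε₀ V},
          ∀ U ∈ fibre F ℰp J K hJK V, U ∈ histGood F ℰp (θBal F.L γ b₀ p₀) K J →
          ∀ g g₀ : (j : ℕ) → Site (F.P K) j → SU2,
            (∀ j, j < K - J → ∀ x, g j x =
              (axialT (lift F K j (GaugeField.gaugeAct (g (j + 1)) (Averaging.iter (fun k => blockAvg (P := F.P K) (j := k) ℰp) (j + 1) U)))
                  (emb (blockOf x)) x)⁻¹ *
                g (j + 1) (blockOf x) * axialT (Averaging.iter (fun k => blockAvg (P := F.P K) (j := k) ℰp) j U) (emb (blockOf x)) x) →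
            (∀ j, K - J ≤ j → ∀ y, g j y = 1) →
            (∀ j, j < K - J → ∀ y : Site (F.P K) (j + 1), g j (emb y) = g (j + 1) y) →
            (∀ X : GaugeField (F.P K) 0 SU2, ∀ j, j ≤ K - J →
              Averaging.iter (fun k => blockAvg (P := F.P K) (j := k) ℰp) j (GaugeField.gaugeAct (g 0) X) =
                GaugeField.gaugeAct (g j) (Averaging.iter (fun k => blockAvg (P := F.P K) (j := k) ℰp) j X)) →
            (∀ j, j < K - J → ∀ x,
              axialT (GaugeField.gaugeAct (g j) (Averaging.iter (fun k => blockAvg (P := F.P K) (j := k) ℰp) j U)) (emb (blockOf x)) x =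
                axialT (lift F K j (GaugeField.gaugeAct (g (j + 1)) (Averaging.iter (fun k => blockAvg (P := F.P K) (j := k) ℰp) (j + 1) U)))
                  (emb (blockOf x)) x) →
            (∀ j, j < K - J →
              (blockAvg (P := F.P K) (j := j) ℰp).avg (GaugeField.gaugeAct (g j) (Averaging.iter (fun k => blockAvg (P := F.P K) (j := k) ℰp) j U)) =
                GaugeField.gaugeAct (g (j + 1)) (Averaging.iter (fun k => blockAvg (P := F.P K) (j := k) ℰp) (j + 1) U)) →
            (∀ j, j < K - J → ∀ x, g₀ j x =
              (axialT (lift F K j (GaugeField.gaugeAct (g₀ (j + 1)) (Averaging.iter (fun k => blockAvg (P := F.P K) (j := k) ℰp) (j + 1) U₀)))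
                  (emb (blockOf x)) x)⁻¹ *
                g₀ (j + 1) (blockOf x) * axialT (Averaging.iter (fun k => blockAvg (P := F.P K) (j := k) ℰp) j U₀) (emb (blockOf x)) x) →
            (∀ j, K - J ≤ j → ∀ y, g₀ j y = 1) →
            (∀ j, j < K - J → ∀ y : Site (F.P K) (j + 1), g₀ j (emb y) = g₀ (j + 1) y) →
            (∀ X : GaugeField (F.P K) 0 SU2, ∀ j, j ≤ K - J →
              Averaging.iter (fun k => blockAvg (P := F.P K) (j := k) ℰp) j (GaugeField.gaugeAct (g₀ 0) X) =
                GaugeField.gaugeAct (g₀ j) (Averaging.iter (fun k => blockAvg (P := F.P K) (j := k) ℰp) j X)) →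
            (∀ j, j < K - J → ∀ x,
              axialT (GaugeField.gaugeAct (g₀ j) (Averaging.iter (fun k => blockAvg (P := F.P K) (j := k) ℰp) j U₀)) (emb (blockOf x)) x =
                axialT (lift F K j (GaugeField.gaugeAct (g₀ (j + 1)) (Averaging.iter (fun k => blockAvg (P := F.P K) (j := k) ℰp) (j + 1) U₀)))
                  (emb (blockOf x)) x) →
            (∀ j, j < K - J →
              (blockAvg (P := F.P K) (j := j) ℰp).avg (GaugeField.gaugeAct (g₀ j) (Averaging.iter (fun k => blockAvg (P := F.P K) (j := k) ℰp) j U₀)) =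
                GaugeField.gaugeAct (g₀ (j + 1)) (Averaging.iter (fun k => blockAvg (P := F.P K) (j := k) ℰp) (j + 1) U₀)) →
            ∃ r e : ℕ → ℝ, (∀ j, 0 ≤ r j) ∧ (∀ j, 0 ≤ e j) ∧ ∑ j ∈ range (K - J), (r j + e j) ≤ E ∧
              ∀ j, j < K - J →
                √(∑ b, ‖logVec (su2Quat (GaugeField.gaugeAct (g (j + 1)) (Averaging.iter (fun k => blockAvg (P := F.P K) (j := k) ℰp) (j + 1) U) b)) -
                      logVec (su2Quat (GaugeField.gaugeAct (g₀ (j + 1)) (Averaging.iter (fun k => blockAvg (P := F.P K) (j := k) ℰp) (j + 1) U₀) b))‖ ^ 2) ≤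
                  (1 + r j) * √(∑ b, dist1 (GaugeField.gaugeAct (g (j + 1)) (Averaging.iter (fun k => blockAvg (P := F.P K) (j := k) ℰp) (j + 1) U) b *
                    (GaugeField.gaugeAct (g₀ (j + 1)) (Averaging.iter (fun k => blockAvg (P := F.P K) (j := k) ℰp) (j + 1) U₀) b)⁻¹) ^ 2) ∧
                √(∑ b, dist1 (GaugeField.gaugeAct (g j) (Averaging.iter (fun k => blockAvg (P := F.P K) (j := k) ℰp) j U) b *
                      (lift F K j (GaugeField.gaugeAct (g (j + 1)) (Averaging.iter (fun k => blockAvg (P := F.P K) (j := k) ℰp) (j + 1) U)) b)⁻¹ *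
                    (GaugeField.gaugeAct (g₀ j) (Averaging.iter (fun k => blockAvg (P := F.P K) (j := k) ℰp) j U₀) b *
                      (lift F K j (GaugeField.gaugeAct (g₀ (j + 1)) (Averaging.iter (fun k => blockAvg (P := F.P K) (j := k) ℰp) (j + 1) U₀)) b)⁻¹)⁻¹) ^ 2) ≤
                  Real.sqrt (F.L : ℝ) * e j * √(∑ b, dist1 (GaugeField.gaugeAct (g (j + 1)) (Averaging.iter (fun k => blockAvg (P := F.P K) (j := k) ℰp) (j + 1) U) b *
                    (GaugeField.gaugeAct (g₀ (j + 1)) (Averaging.iter (fun k => blockAvg (P := F.P K) (j := k) ℰp) (j + 1) U₀) b)⁻¹) ^ 2) +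
                    C * Real.sqrt (F.L : ℝ) ^ j *
                      √(∑ p, dist1 ((GaugeField.plaqHol (GaugeField.gaugeAct (g₀ 0) U₀) p)⁻¹ * GaugeField.plaqHol (GaugeField.gaugeAct (g 0) U) p) ^ 2)) :
    ∀ (L : ℕ), ∃ c₀ : ℝ, 0 < c₀ ∧ c₀ ≤ 1 ∧ ∀ (cw : ℝ), 0 < cw → cw ≤ c₀ → ∃ pS : ℝ, ∀ (b₀ p₀ : ℝ), 0 < b₀ → pS ≤ p₀ → 0 < p₀ → ∃ ε₁ : ℝ, 0 < ε₁ ∧ ∀ (ε₀ : ℝ), 0 < ε₀ → ε₀ ≤ ε₁ →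
    ∃ γ₁ : ℝ, 0 < γ₁ ∧ ∃ C_D : ℝ, 0 < C_D ∧ ∀ (F : T3Family) (γ : ℝ), F.L = L → 0 < γ → γ ≤ γ₁ →
      ∀ (J K : ℕ) (hJK : J ≤ K) (V : GaugeField (F.P J) 0 (Matrix.specialUnitaryGroup (Fin 2) ℂ)), PlaqSmall (θBal F.L γ (cw * b₀) p₀ J) V →
        G F J V →
        ∀ U₀ ∈ {U' : GaugeField (F.P K) 0 (Matrix.specialUnitaryGroup (Fin 2) ℂ) | U' ∈ fibre F ℰp J K hJK V ∧ U' ∈ histGood F ℰp (θBal F.L γ b₀ p₀) K J ∧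
            wilsonAction4 U' = minActionRegPr F J K hJK ε₀ V},
        ∀ U ∈ fibre F ℰp J K hJK V, U ∈ histGood F ℰp (θBal F.L γ b₀ p₀) K J →
          ∃ w : GaugeTransf (F.P K) 0 (Matrix.specialUnitaryGroup (Fin 2) ℂ),
            (∀ U' : GaugeField (F.P K) 0 (Matrix.specialUnitaryGroup (Fin 2) ℂ),
              descendTo F ℰp J K hJK (GaugeField.gaugeAct w U') = descendTo F ℰp J K hJK U') ∧
            ((F.L : ℝ)⁻¹) ^ (2 * (K - J)) * ∑ ℓ : PBond (F.P K) 0, dist1 (U ℓ * ((GaugeField.gaugeAct w U₀) ℓ)⁻¹) ^ 2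
              ≤ C_D * ∑ p : Plaq (F.P K) 0, (1 - reTr ((GaugeField.plaqHol (GaugeField.gaugeAct w U₀) p)⁻¹ * GaugeField.plaqHol U p)) := by
  intro L
  obtain ⟨c₀, hc₀, hc₀1, H1⟩ := HL L
  refine ⟨c₀, hc₀, hc₀1, fun cw hcw hcwle => ?_⟩
  obtain ⟨pS, H1⟩ := H1 cw hcw hcwle
  refine ⟨pS, fun b₀ p₀ hb hpS hp => ?_⟩
  obtain ⟨ε₁, hε₁, H1⟩ := H1 b₀ p₀ hb hpS hp
  refine ⟨ε₁, hε₁, fun ε₀ hε₀ hε₀le => ?_⟩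
  obtain ⟨γ₁, hγ₁, E, C, hC, H1⟩ := H1 ε₀ hε₀ hε₀le
  by_cases hL : 1 < L
  · have hL' : (1 : ℝ) < L := by exact_mod_cast hL
    have hCD : 0 < 2 * (Real.exp E * C / ((L : ℝ) - 1)) ^ 2 := by
      have : 0 < Real.exp E * C / ((L : ℝ) - 1) := div_pos (mul_pos (Real.exp_pos E) hC) (by linarith)
      positivity
    refine ⟨γ₁, hγ₁, 2 * (Real.exp E * C / ((L : ℝ) - 1)) ^ 2, hCD, fun F γ hFL hγ hγle J K hJK V hV hG U₀ hU₀ U hU hUg => ?_⟩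
    have hFL' : (F.L : ℝ) = L := by exact_mod_cast hFL
    have hLF : 1 < (F.L : ℝ) := by rw [hFL']; exact hL'
    have h := dockRel_inner F hJK hLF U U₀ hU hU₀.1 (lift F K) (fun j hj X X' => hR1 F K J j hj X X') C E hC
      (fun g g₀ h0 h1 h2 h3 h4 h5 h0' h1' h2' h3' h4' h5' =>
        H1 F γ hFL hγ hγle J K hJK V hV hG U₀ hU₀ U hU hUg g g₀ h0 h1 h2 h3 h4 h5 h0' h1' h2' h3' h4' h5')
    rw [hFL'] at h ⊢
    exact h
  · -- block sizes `L ≤ 1` carry no `T3Family` with `1 < F.L`: vacuous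
    exact ⟨γ₁, hγ₁, 1, one_pos, fun F γ hFL => absurd (hFL ▸ F.hL.2) hL⟩

end Summit.QuantumFields.YangMills.Theorems.FluctuationComparisonRegPrIntLS2BetaRelGaugeOfRelativeLetter

end
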